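import Literature.MathematicalPhysics.QuantumLattice.SpinChainsAkltFrustrationFreeProofs
import Literature.MathematicalPhysics.QuantumLattice.MatrixProductStatesAkltTransferProofs
import HarnessLib

/-!
# The AKLT bond projection: placement of two-site operators, projection calculus, slices

Trunk **T-QLATTICE**. First sibling proof file of
`Literature/MathematicalPhysics/QuantumLattice/SpinChains.lean` towards the AKLT theorems
(`aklt_gap`). It is theorem-only apart from two bookkeeping definitions (`pairEmb`, `placePair`)
and the abbreviation `akltProj` for the bond-spin-`2` projection
`P₂(x,y) = ⅙ (𝐒_x·𝐒_y)² + ½ 𝐒_x·𝐒_y + ⅓`; no `Prop`-valued definition (named fact) is introduced.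

* `placePair x y P` places a two-site operator `P : Op (Fin 2) q` at the ordered pair of distinct
  sites `(x, y)` of `Λ` (`localOp {x, y}` after relabelling `Fin 2 ≃ {x, y}`); it is a unital
  algebra homomorphism sending `onSite 0 a ↦ onSite x a`, `onSite 1 a ↦ onSite y a`
  (`LocalOpTransport`), hence `𝐒₀·𝐒₁ ↦ 𝐒_x·𝐒_y` (`placePair_spinDot`).
* `akltProj x y = placePair x y (parentLocalTerm 2 akltTensor)` (`akltProj_eq_placePair`, from
  `parentLocalTerm_two_akltTensor`): the AKLT bond term is `h_{xy} = 2 P₂(x,y) - 2/3`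
  (`akltBond_eq`), `P₂(x,y)` is an orthogonal projection (`akltProj_isHermitian`,
  `akltProj_mul_self`, `posSemidef_akltProj`) supported on `{x, y}`, projections on disjoint
  bonds commute (`akltProj_commute_of_disjoint`), and
  `akltRing L = 2 Σ_i P₂(i,i+1) - (2L/3)·1` with `Σ_i P₂(i,i+1) = parentHamiltonian L 2 akltTensor`
  (`akltRing_eq`, `sum_akltProj_eq_parentHamiltonian`). (The companion facts for the bonds
  `(x, x+1)` of the ring, phrased without the abbreviation `akltProj`, are in
  `SpinChainsAkltFrustrationFreeProofs`.)

## Sources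

I. Affleck, T. Kennedy, E. H. Lieb, H. Tasaki, *Valence bond ground states in isotropic quantum
antiferromagnets*, Comm. Math. Phys. **115** (1988) 477–528, eq. (1.2) and §2 (the bond term is
the spin-2 projection up to constants); M. Fannes, B. Nachtergaele, R. F. Werner, Comm. Math.
Phys. **144** (1992) 443–490, eq. (1.1) p. 445 and §7 pp. 485–486; H. Tasaki, *Physics and
Mathematics of Quantum Many-Body Systems* (Springer, 2020), §7.1, eq. (7.1.1)–(7.1.3);
O. Bratteli, D. W. Robinson, *Operator Algebras and Quantum Statistical Mechanics II*, §6.2.1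
(local algebras, `A ↦ A ⊗ 𝟙`).
-/

noncomputable section

open Matrix Complex Finset
open scoped ComplexOrder

namespace Literature.MathematicalPhysics.QuantumLattice

section QLattice

variable {Λ : Type*} [Fintype Λ] [DecidableEq Λ] {q : ℕ}

/-! ### Placing a two-site operator at an ordered pair of sites -/

/-- The labelling of the pair `{x, y} ⊆ Λ` by `Fin 2`: `0 ↦ x`, `1 ↦ y`. [folklore] -/
def pairEmb (x y : Λ) : Fin 2 → (({x, y} : Finset Λ) : Type _) :=
  ![⟨x, mem_insert_self x {y}⟩, ⟨y, mem_insert_of_mem (mem_singleton_self y)⟩]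

omit [Fintype Λ] in
/-- The label `0` is the site `x`. [folklore] -/
@[simp] theorem coe_pairEmb_zero (x y : Λ) : ((pairEmb x y 0 : ({x, y} : Finset Λ)) : Λ) = x := rfl

omit [Fintype Λ] in
/-- The label `1` is the site `y`. [folklore] -/
@[simp] theorem coe_pairEmb_one (x y : Λ) : ((pairEmb x y 1 : ({x, y} : Finset Λ)) : Λ) = y := rfl

omit [Fintype Λ] in
/-- For `x ≠ y` the labelling `pairEmb x y : Fin 2 → {x, y}` is a bijection. [folklore] -/
theorem pairEmb_bijective {x y : Λ} (hxy : x ≠ y) : Function.Bijective (pairEmb x y) := by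
  refine ⟨fun i j hij => ?_, fun z => ?_⟩
  · have h := congrArg Subtype.val hij
    fin_cases i <;> fin_cases j
    · rfl
    · exact absurd h hxy
    · exact absurd h.symm hxy
    · rfl
  · obtain ⟨z, hz⟩ := z
    rcases mem_insert.1 hz with rfl | hz'
    · exact ⟨0, rfl⟩
    · rw [mem_singleton] at hz'
      subst hz'
      exact ⟨1, rfl⟩

/-- **Placement of a two-site operator.** `placePair x y P` is the operator `P : Op (Fin 2) q`
acting on the ordered pair of sites `(x, y)` of `Λ` and as the identity elsewhere:
`localOp {x, y}` of `P` relabelled along `pairEmb x y`. (Meaningful for `x ≠ y`.)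
Bratteli–Robinson II §6.2.1 (`𝔄_{{x,y}} ↪ 𝔄_Λ`). [folklore] -/
def placePair (x y : Λ) (P : Op (Fin 2) q) : Op Λ q :=
  localOp {x, y} (P.submatrix (fun σ j => σ (pairEmb x y j)) (fun σ j => σ (pairEmb x y j)))

/-- Placement is additive. [folklore] -/
theorem placePair_add (x y : Λ) (P Q : Op (Fin 2) q) :
    placePair x y (P + Q) = placePair x y P + placePair x y Q :=
  localOp_submatrix_add _ _ P Q

/-- Placement commutes with scalars. [folklore] -/
theorem placePair_smul (x y : Λ) (c : ℂ) (P : Op (Fin 2) q) :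
    placePair x y (c • P) = c • placePair x y P :=
  localOp_submatrix_smul _ _ c P

/-- Placement at a pair of *distinct* sites is unital. [folklore] -/
theorem placePair_one {x y : Λ} (hxy : x ≠ y) : placePair x y (1 : Op (Fin 2) q) = 1 :=
  localOp_submatrix_one _ (pairEmb_bijective hxy)

/-- Placement at a pair of *distinct* sites is multiplicative. [folklore] -/
theorem placePair_mul {x y : Λ} (hxy : x ≠ y) (P Q : Op (Fin 2) q) :
    placePair x y (P * Q) = placePair x y P * placePair x y Q :=
  localOp_submatrix_mul _ (pairEmb_bijective hxy) P Q

/-- Placement sends the single-site operator at the abstract site `0` to the one at `x`.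
[folklore] -/
theorem placePair_onSite_zero {x y : Λ} (hxy : x ≠ y) (a : Matrix (Fin q) (Fin q) ℂ) :
    placePair x y (onSite (0 : Fin 2) a) = onSite x a := by
  rw [placePair, localOp_submatrix_onSite _ (pairEmb_bijective hxy), coe_pairEmb_zero]

/-- Placement sends the single-site operator at the abstract site `1` to the one at `y`.
[folklore] -/
theorem placePair_onSite_one {x y : Λ} (hxy : x ≠ y) (a : Matrix (Fin q) (Fin q) ℂ) :
    placePair x y (onSite (1 : Fin 2) a) = onSite y a := by
  rw [placePair, localOp_submatrix_onSite _ (pairEmb_bijective hxy), coe_pairEmb_one]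

/-- Placement is a `⋆`-map. [folklore] -/
theorem placePair_conjTranspose (x y : Λ) (P : Op (Fin 2) q) :
    placePair x y Pᴴ = (placePair x y P)ᴴ := by
  rw [placePair, placePair, ← localOp_conjTranspose]
  rfl

/-- Placement preserves positivity. [folklore] -/
theorem posSemidef_placePair (x y : Λ) {P : Op (Fin 2) q} (hP : P.PosSemidef) :
    (placePair x y P).PosSemidef :=
  posSemidef_localOp _ (hP.submatrix _)

/-- A placed operator is supported on the pair of sites. [folklore] -/
theorem isSupportedOn_placePair (x y : Λ) (P : Op (Fin 2) q) :
    IsSupportedOn (placePair x y P) {x, y} :=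
  ⟨_, rfl⟩

/-- **The placed exchange operator**: `placePair x y (𝐒₀ · 𝐒₁) = 𝐒_x · 𝐒_y` for `x ≠ y`.
Tasaki (2020) §2.4; Bratteli–Robinson II §6.2.1. [folklore] -/
theorem placePair_spinDot {x y : Λ} (hxy : x ≠ y) (n : ℕ) :
    placePair x y (spinDot n (0 : Fin 2) 1) = spinDot n x y := by
  have hg := pairEmb_bijective hxy
  simp only [placePair, spinDot, spinBond, siteSpin, localOp_submatrix_sum,
    localOp_submatrix_smul, localOp_submatrix_add, localOp_submatrix_mul _ hg,
    localOp_submatrix_onSite _ hg, coe_pairEmb_zero, coe_pairEmb_one]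

/-! ### The AKLT bond projection `P₂(x,y)` -/

/-- The bond-spin-`2` projection of two spins `1` at the sites `x, y`:
`P₂(x,y) = ⅙ (𝐒_x·𝐒_y)² + ½ 𝐒_x·𝐒_y + ⅓` (an honest abbreviation for this polynomial in the
exchange operator; for `x ≠ y` it is an orthogonal projection, `akltProj_mul_self`). AKLT, CMP 115
(1988), eq. (1.2) and §2; Tasaki (2020) §7.1, eq. (7.1.2); Fannes–Nachtergaele–Werner (1992)
eq. (1.1). [folklore] -/
def akltProj (x y : Λ) : Op Λ 3 :=
  (1 / 6 : ℂ) • (spinDot 2 x y * spinDot 2 x y) + (1 / 2 : ℂ) • spinDot 2 x y +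
    (1 / 3 : ℂ) • (1 : Op Λ 3)

/-- **The AKLT bond term is `2 P₂ - 2/3`**: `𝐒_x·𝐒_y + ⅓ (𝐒_x·𝐒_y)² = 2 P₂(x,y) - ⅔·1`.
AKLT (1988), eq. (1.2); Tasaki (2020) §7.1, eq. (7.1.2)–(7.1.3). [folklore] -/
theorem akltBond_eq (x y : Λ) :
    akltBond x y = (2 : ℂ) • akltProj x y - (2 / 3 : ℂ) • (1 : Op Λ 3) := by
  simp only [akltBond, akltProj, smul_add, smul_smul]
  module

/-- **`P₂(x,y)` is the placed two-site parent term of the AKLT tensor** (`x ≠ y`):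
`akltProj x y = placePair x y (1 - P_{𝒢₂})`, by `parentLocalTerm_two_akltTensor` and the
homomorphism property of placement. Fannes–Nachtergaele–Werner (1992) eq. (1.1) and §7. [folklore] -/
theorem akltProj_eq_placePair {x y : Λ} (hxy : x ≠ y) :
    akltProj x y = placePair x y (parentLocalTerm 2 akltTensor) := by
  rw [parentLocalTerm_two_akltTensor, placePair_add, placePair_add, placePair_smul,
    placePair_smul, placePair_smul, placePair_mul hxy, placePair_one hxy, placePair_spinDot hxy]
  rfl

/-- `P₂(x,y)` is Hermitian. [folklore] -/
theorem akltProj_isHermitian (x y : Λ) : (akltProj x y).IsHermitian := by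
  have hD : (spinDot 2 x y)ᴴ = spinDot 2 x y := (spinDot_isHermitian 2 x y).eq
  unfold akltProj IsHermitian
  simp only [conjTranspose_add, conjTranspose_smul, conjTranspose_mul, conjTranspose_one, hD,
    Complex.star_def, map_div₀, map_one, map_ofNat]

/-- **`P₂(x,y)` is idempotent** (`x ≠ y`): it is an orthogonal projection (the placed
`projMatrix`). AKLT (1988) §2; Tasaki (2020) §7.1. [folklore] -/
theorem akltProj_mul_self {x y : Λ} (hxy : x ≠ y) : akltProj x y * akltProj x y = akltProj x y := by
  rw [akltProj_eq_placePair hxy, ← placePair_mul hxy, parentLocalTerm, projMatrix_mul_self]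

/-- `P₂(x,y)` is positive semidefinite (`x ≠ y`). [folklore] -/
theorem posSemidef_akltProj {x y : Λ} (hxy : x ≠ y) : (akltProj x y).PosSemidef := by
  rw [akltProj_eq_placePair hxy]
  exact posSemidef_placePair _ _ (parentLocalTerm_posSemidef 2 akltTensor)

/-- `P₂(x,y)` is supported on `{x, y}` (`x ≠ y`). [folklore] -/
theorem isSupportedOn_akltProj {x y : Λ} (hxy : x ≠ y) : IsSupportedOn (akltProj x y) {x, y} := by
  rw [akltProj_eq_placePair hxy]
  exact isSupportedOn_placePair _ _ _

/-- **Projections on disjoint bonds commute**: `[P₂(x,y), P₂(z,w)] = 0` when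
`{x, y} ∩ {z, w} = ∅` (locality). Knabe, J. Stat. Phys. 52 (1988) 627, §2; Tasaki (2020) §7.1. [folklore] -/
theorem akltProj_commute_of_disjoint {x y z w : Λ} (hxy : x ≠ y) (hzw : z ≠ w)
    (h : Disjoint ({x, y} : Finset Λ) {z, w}) : Commute (akltProj x y) (akltProj z w) :=
  commute_of_disjoint_holds (isSupportedOn_akltProj hxy) (isSupportedOn_akltProj hzw) h

/-! ### The AKLT ring in terms of the bond projections -/

/-- In `ℤ/L` with `2 ≤ L`, consecutive sites are distinct: `i ≠ i + 1`. [folklore] -/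
theorem self_ne_add_one {L : ℕ} (hL : 2 ≤ L) (i : ZMod L) : i ≠ i + 1 := by
  intro h
  have h1 : (1 : ZMod L) = 0 := by
    have := congrArg (· - i) h
    simpa using this.symm
  rw [ZMod.one_eq_zero_iff] at h1
  omega

/-- **`Σ_i P₂(i,i+1)` is the AKLT parent Hamiltonian** on the ring `ℤ/L`, `2 ≤ L`
(`parentHamiltonian_akltTensor_eq_holds`). Fannes–Nachtergaele–Werner (1992) eq. (1.1), §7. [folklore] -/
theorem sum_akltProj_eq_parentHamiltonian (L : ℕ) [NeZero L] (hL : 2 ≤ L) :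
    ∑ i : ZMod L, akltProj i (i + 1) = parentHamiltonian L 2 akltTensor := by
  rw [parentHamiltonian_akltTensor_eq_holds L hL]
  rfl

/-- **The AKLT ring is `2 Σ_i P₂(i,i+1) - (2L/3)·1`.** AKLT (1988), eq. (1.2); Tasaki (2020)
§7.1, eq. (7.1.3). [folklore] -/
theorem akltRing_eq (L : ℕ) [NeZero L] :
    akltRing L = (2 : ℂ) • ∑ i : ZMod L, akltProj i (i + 1) - ((2 / 3 : ℂ) * L) • (1 : Op (ZMod L) 3) := by
  unfold akltRing
  simp only [akltBond_eq, Finset.sum_sub_distrib, ← Finset.smul_sum, Finset.sum_const,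
    Finset.card_univ, ZMod.card]
  rw [← Nat.cast_smul_eq_nsmul ℂ, smul_smul, mul_comm]

end QLattice

end Literature.MathematicalPhysics.QuantumLattice
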